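import Summits.BirchSwinnertonDyer.Rank1Residual.X11b.InterpolationCharacterSupplyShapes
import Summits.BirchSwinnertonDyer.Rank1Residual.X11b.BDPRouteIntSeriesContinuity
import HarnessLib

/-!
# Class X11b, every prime `p`: VALUE-AT-𝟙 RIGIDITY ACROSS PERIODS over the WIDE RECEPTACLE
# `𝓞_{ℂ_p}⟦T⟧` (♭-V1RIG) — two ♭-frames `R1.IsBDPLFunctionInt p ι 𝔭 κ γ f Ω_K Ω_p Q`,
# `… Ω_K' Ω_p' Q'` of the SAME `(ι, 𝔭, κ, γ, f)` with ANY non-zero periods have `[T⁰]Q' = [T⁰]Q`;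
# at anticyclotomic data (odd `p`) WITHOUT supply hypotheses (cell `b2b-bsdres`, sub-cell
# `multr1-p2`, gen 25)

HONEST FRAMING (cell `b2b-bsdres`, run/shared/lean/b2b/bsd-rank1-residual/, verbatim in every
file): the goal of the cell is to DELETE the COMBINATION-SHAPED residual classes of the
Birch–Swinnerton-Dyer formula for ALL analytic-rank `≤ 1` elliptic curves over `ℚ` — "full BSD
formula for every rank `≤ 1` curve in class `C`" assembled STRICTLY from published theorems — so
that the rank-`≤ 1` remainder becomes exactly the CONSTRUCTION-SHAPED classes, which are TYPED
(missing-input `Prop`s), NOT attempted. This is not "finishing BSD". Sub-cell `multr1-p2` is a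
RESEARCH ROUTE on class X11b (`ClassX11b W p := r_an = 1 ∧ p ≠ 2 ∧ mult(p) ∧ irr(p)`); no claim
beyond the stated class and loci; X11b's label does not change; NOTHING is booked by this file.

THEOREMS ONLY (elementary `p`-adic analysis on `𝓞_{ℂ_p}⟦T⟧`; no definition, no named fact, no
`sorry`). CREDIT: this is the `IntSeries`/`𝓞_{ℂ_p}⟦T⟧` twin of team x11b3's S27 'V1RIG' —
`X11b/UnrSeriesValueRigidity.lean` (abstract core `Halves.constantCoeff_eq_of_values_mul_sq`) and
`X11b/BDPValueRigidity.lean` (`constantCoeff_eq_of_isBDPLFunction_of_supply`), seat `b2b-bsdres-x11b3-p3`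
(p263231 / p263893 / p264499) —, whose proofs are followed VERBATIM with `R₀ ↦ 𝓞_{ℂ_p}`; x11b3
declined the port for lack of a consumer at `3` (x11b3-lead 2026-08-21 13:05Z) and freed this sub-cell
to file it; their `ℂ_p`-side lemmas (`Halves.eventually_norm_eq_of_tendsto`,
`bdpInterpolationValue_rescale`, `frameValue_rescale`) are IMPORTED, not restated.

## Why (route p2)

Route p2's open input H∃♭ `P2.IMCDivIntFrameOnTree` asks, per datum, for ONE ♭-frame `(Ω_K, Ω_p, Q)`
with [3.1♭] Castella's interpolation ∧ [3.2♭] the value at `𝟙` ∧ [(2.4)♭] the divisibility. With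
♭-V1RIG the VALUE conjunct can be read off ANY ♭-frame at the datum (all frames of the same
`(ι, 𝔭, κ, γ, f)` have the same constant term), so H∃♭ SPLITS into "(2.4) for some frame" + "the value
at `𝟙` for some (possibly other) frame" — the second being PUBLISHED on semistable pairs (Cas18 Thms.
3.1–3.2 via `h32`). That split is the sequel file `X11b/BDPRouteOpenInputSplit.lean`.

## What this file proves

* §1 values of `Q ∈ 𝓞_{ℂ_p}⟦T⟧` on the open disc: absolute convergence, existence
  (`intSeries_exists_hasValueAt`), product rule (`intSeries_hasValueAt_mul`), monomials, the ORDER LEMMA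
  `intSeries_norm_value_eq_of_order` (`‖F(x)‖ = ‖x‖^d·‖[T^d]F‖` for `‖x‖ < ‖[T^d]F‖`, `d = ord F`).
* §2 the abstract core `intSeries_constantCoeff_eq_of_values_mul_sq` (values tied by `a_k` and `a_k²`
  along `T_k → 0` ⟹ equal constant terms; x11b3-p3's argument verbatim).
* the BDP-level statements (**`constantCoeff_eq_of_isBDPLFunctionInt_of_supply`**, any `p`, and
  **`constantCoeff_eq_of_isBDPLFunctionInt_of_isAnticyclotomic`**, odd `p`, NO supply hypothesis) are the
  sequel file `X11b/BDPValueRigidityInt.lean`.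

## References

* [Castella2018] F. Castella, Math. Ann. 370 (2018), Thms. 3.1–3.2 (arXiv:1704.06608 pp. 8–9).
* [CastellaHsieh2018] §3.3, Def. 3.5, Prop. 3.6. * [Cassels1986] J. W. S. Cassels, *Local Fields*,
  Ch. 4 Lemma 2.1 (power series on the open disc). * [Hsieh2014] p. 7 (the receptacle).
-/

noncomputable section

open scoped Classical Topology NumberField
open Filter NumberField IsDedekindDomain Field PowerSeries
  Literature.NumberTheory.EllipticCurves Literature.NumberTheory.GaloisRepresentations

namespace Summit.BirchSwinnertonDyer.Rank1Residual.X11b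

variable {p : ℕ} [Fact p.Prime]

/-! ### §1 Values of `𝓞_{ℂ_p}⟦T⟧` on the open unit disc -/

section Values

/-- The `k`-th term of `Q(x)` has norm `≤ ‖x‖^k` (`𝓞_{ℂ_p} = {‖·‖ ≤ 1}`). [folklore] -/
theorem intSeries_norm_coeff_mul_pow_le (Q : PowerSeries 𝓞_ℂ_[p]) (x : ℂ_[p]) (k : ℕ) :
    ‖((coeff k Q : 𝓞_ℂ_[p]) : ℂ_[p]) * x ^ k‖ ≤ ‖x‖ ^ k := by
  rw [norm_mul, norm_pow]
  exact mul_le_of_le_one_left (pow_nonneg (norm_nonneg _) _) (R1.norm_coe_padicComplexInt_le_one p _)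

/-- On the open unit disc every `Q ∈ 𝓞_{ℂ_p}⟦T⟧` converges ABSOLUTELY (geometric bound). [folklore] -/
theorem intSeries_summable_norm (Q : PowerSeries 𝓞_ℂ_[p]) {x : ℂ_[p]} (hx : ‖x‖ < 1) :
    Summable fun k : ℕ ↦ ‖((coeff k Q : 𝓞_ℂ_[p]) : ℂ_[p]) * x ^ k‖ :=
  (summable_geometric_of_lt_one (norm_nonneg x) hx).of_nonneg_of_le (fun _ ↦ norm_nonneg _)
    (intSeries_norm_coeff_mul_pow_le Q x)

/-- On the open unit disc the value of `Q` exists and is the sum of the series. [folklore] -/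
theorem intSeries_hasValueAt_tsum (Q : PowerSeries 𝓞_ℂ_[p]) {x : ℂ_[p]} (hx : ‖x‖ < 1) :
    IntSeries.HasValueAt Q x (∑' k : ℕ, ((coeff k Q : 𝓞_ℂ_[p]) : ℂ_[p]) * x ^ k) :=
  (intSeries_summable_norm Q hx).of_norm.hasSum

/-- On the open unit disc every `Q ∈ 𝓞_{ℂ_p}⟦T⟧` has a value. [folklore] -/
theorem intSeries_exists_hasValueAt (Q : PowerSeries 𝓞_ℂ_[p]) {x : ℂ_[p]} (hx : ‖x‖ < 1) :
    ∃ v : ℂ_[p], IntSeries.HasValueAt Q x v :=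
  ⟨_, intSeries_hasValueAt_tsum Q hx⟩

/-- **Product rule** on the open unit disc (Cauchy product of two absolutely convergent series in the
complete field `ℂ_p`). [folklore] -/
theorem intSeries_hasValueAt_mul {Q R : PowerSeries 𝓞_ℂ_[p]} {x v w : ℂ_[p]} (hx : ‖x‖ < 1)
    (hQ : IntSeries.HasValueAt Q x v) (hR : IntSeries.HasValueAt R x w) :
    IntSeries.HasValueAt (Q * R) x (v * w) := by
  set f : ℕ → ℂ_[p] := fun k ↦ ((coeff k Q : 𝓞_ℂ_[p]) : ℂ_[p]) * x ^ k with hf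
  set g : ℕ → ℂ_[p] := fun k ↦ ((coeff k R : 𝓞_ℂ_[p]) : ℂ_[p]) * x ^ k with hg
  have hQ' : HasSum f v := hQ
  have hR' : HasSum g w := hR
  have hfn : Summable fun k ↦ ‖f k‖ := intSeries_summable_norm Q hx
  have hgn : Summable fun k ↦ ‖g k‖ := intSeries_summable_norm R hx
  have hsum : HasSum (fun n ↦ ∑ kl ∈ Finset.HasAntidiagonal.antidiagonal n, f kl.1 * g kl.2)
      (v * w) := by
    rw [← hQ'.tsum_eq, ← hR'.tsum_eq, tsum_mul_tsum_eq_tsum_sum_antidiagonal_of_summable_norm hfn hgn]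
    exact (summable_norm_sum_mul_antidiagonal_of_summable_norm hfn hgn).of_norm.hasSum
  have hterm : (fun n ↦ ∑ kl ∈ Finset.HasAntidiagonal.antidiagonal n, f kl.1 * g kl.2) =
      fun n ↦ ((coeff n (Q * R) : 𝓞_ℂ_[p]) : ℂ_[p]) * x ^ n := by
    funext n
    rw [coeff_mul, AddSubmonoidClass.coe_finsetSum, Finset.sum_mul]
    refine Finset.sum_congr rfl fun kl hkl ↦ ?_
    rw [Finset.HasAntidiagonal.mem_antidiagonal] at hkl
    simp only [hf, hg, MulMemClass.coe_mul, ← hkl, pow_add]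
    ring
  rw [hterm] at hsum
  exact hsum

/-- The monomial `T^d ∈ 𝓞_{ℂ_p}⟦T⟧` has value `x^d` at `x`. [folklore] -/
theorem intSeries_hasValueAt_X_pow (d : ℕ) (x : ℂ_[p]) :
    IntSeries.HasValueAt ((X : PowerSeries 𝓞_ℂ_[p]) ^ d) x (x ^ d) := by
  unfold IntSeries.HasValueAt
  have h := hasSum_single (f := fun k : ℕ ↦
    ((coeff k ((X : PowerSeries 𝓞_ℂ_[p]) ^ d) : 𝓞_ℂ_[p]) : ℂ_[p]) * x ^ k) d
    (fun k hk ↦ by simp [coeff_X_pow, hk])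
  simpa [coeff_X_pow] using h

/-- The zero series has value `0` everywhere. [folklore] -/
theorem intSeries_hasValueAt_zero_series (x : ℂ_[p]) :
    IntSeries.HasValueAt (0 : PowerSeries 𝓞_ℂ_[p]) x 0 := by
  unfold IntSeries.HasValueAt
  simp

/-- **Order controls the size of values near `0`** (`𝓞_{ℂ_p}⟦T⟧` twin of x11b3-p3's
`Halves.norm_value_eq_of_order`): for `F = T^d·g`, `d = ord F`, at `‖x‖ < 1` with `‖x‖ < ‖[T^d]F‖`,
`‖F(x)‖ = ‖x‖^d·‖[T^d]F‖`. [cite: Cassels1986, Ch. 4 Lemma 2.1] -/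
theorem intSeries_norm_value_eq_of_order {F : PowerSeries 𝓞_ℂ_[p]} {x u : ℂ_[p]} (hx : ‖x‖ < 1)
    (hxg : ‖x‖ < ‖((coeff F.order.toNat F : 𝓞_ℂ_[p]) : ℂ_[p])‖)
    (hu : IntSeries.HasValueAt F x u) :
    ‖u‖ = ‖x‖ ^ F.order.toNat * ‖((coeff F.order.toNat F : 𝓞_ℂ_[p]) : ℂ_[p])‖ := by
  set d := F.order.toNat with hd
  obtain ⟨g, hg⟩ := X_pow_order_dvd (φ := F)
  have hg0 : constantCoeff g = coeff d F := by
    rw [← coeff_zero_eq_constantCoeff_apply, hg, ← hd]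
    simpa using (coeff_X_pow_mul g d 0).symm
  obtain ⟨ug, hug⟩ := intSeries_exists_hasValueAt g hx
  have hval : IntSeries.HasValueAt F x (x ^ d * ug) := by
    rw [hg, ← hd]
    exact intSeries_hasValueAt_mul hx (intSeries_hasValueAt_X_pow d x) hug
  have hu' : u = x ^ d * ug := hu.unique hval
  have hg0' : ((constantCoeff g : 𝓞_ℂ_[p]) : ℂ_[p]) = ((coeff d F : 𝓞_ℂ_[p]) : ℂ_[p]) := by
    rw [hg0]
  have hne : ((coeff d F : 𝓞_ℂ_[p]) : ℂ_[p]) ≠ 0 := by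
    intro h0
    rw [h0, norm_zero] at hxg
    exact (norm_nonneg x).not_gt hxg
  have hnear : ‖ug - ((coeff d F : 𝓞_ℂ_[p]) : ℂ_[p])‖ < ‖((coeff d F : 𝓞_ℂ_[p]) : ℂ_[p])‖ :=
    (hg0' ▸ intSeries_norm_value_sub_constantCoeff_le hx.le hug).trans_lt hxg
  have hug_norm : ‖ug‖ = ‖((coeff d F : 𝓞_ℂ_[p]) : ℂ_[p])‖ := by
    calc ‖ug‖ = ‖(ug - ((coeff d F : 𝓞_ℂ_[p]) : ℂ_[p])) + ((coeff d F : 𝓞_ℂ_[p]) : ℂ_[p])‖ := by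
          rw [sub_add_cancel]
      _ = max ‖ug - ((coeff d F : 𝓞_ℂ_[p]) : ℂ_[p])‖ ‖((coeff d F : 𝓞_ℂ_[p]) : ℂ_[p])‖ :=
          IsUltrametricDist.norm_add_eq_max_of_norm_ne_norm (ne_of_lt hnear)
      _ = ‖((coeff d F : 𝓞_ℂ_[p]) : ℂ_[p])‖ := max_eq_right hnear.le
  rw [hu', norm_mul, norm_pow, hug_norm]

end Values

/-! ### §2 The abstract core over `𝓞_{ℂ_p}⟦T⟧`: values tied by `a_k` and `a_k²` along `T_k → 0` -/

section Core

open Summit.BirchSwinnertonDyer.Rank1Residual.X11b.Halves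

/-- **Abstract core, one-sided** (`[T⁰]Q ≠ 0`; x11b3-p3's `Halves.constantCoeff_eq_of_values_mul_sq_of_ne_zero`
with `R₀ ↦ 𝓞_{ℂ_p}`, proof verbatim): along `T_k → 0` let `Q, Q'` take the values `v_k`, `a_k·v_k` at
`T_k` and `w_k`, `a_k²·w_k` at `T_k·(T_k + 2)`, with `a_k ≠ 0`; then `[T⁰]Q' = [T⁰]Q`. [folklore] -/
theorem intSeries_constantCoeff_eq_of_values_mul_sq_of_ne_zero {Q Q' : PowerSeries 𝓞_ℂ_[p]}
    {T v w a : ℕ → ℂ_[p]} (hT0 : Tendsto T atTop (𝓝 0)) (ha : ∀ k, a k ≠ 0)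
    (hv : ∀ k, IntSeries.HasValueAt Q (T k) (v k))
    (hv' : ∀ k, IntSeries.HasValueAt Q' (T k) (a k * v k))
    (hw : ∀ k, IntSeries.HasValueAt Q (T k * (T k + 2)) (w k))
    (hw' : ∀ k, IntSeries.HasValueAt Q' (T k * (T k + 2)) (a k ^ 2 * w k))
    (hc : constantCoeff Q ≠ 0) :
    constantCoeff Q' = constantCoeff Q := by
  set c : ℂ_[p] := ((constantCoeff Q : 𝓞_ℂ_[p]) : ℂ_[p]) with hcdef
  set c' : ℂ_[p] := ((constantCoeff Q' : 𝓞_ℂ_[p]) : ℂ_[p]) with hc'def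
  have hc0 : c ≠ 0 := by
    rw [hcdef, Ne, ZeroMemClass.coe_eq_zero]
    exact hc
  have hT2 : Tendsto (fun k ↦ T k + 2) atTop (𝓝 2) := by simpa using hT0.add_const 2
  have hT'0 : Tendsto (fun k ↦ T k * (T k + 2)) atTop (𝓝 0) := by simpa using hT0.mul hT2
  -- (i) the four limits
  have hv_lim : Tendsto v atTop (𝓝 c) := intSeries_tendsto_value_of_tendsto_zero hT0 hv
  have hw_lim : Tendsto w atTop (𝓝 c) := intSeries_tendsto_value_of_tendsto_zero hT'0 hw
  have hav_lim : Tendsto (fun k ↦ a k * v k) atTop (𝓝 c') :=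
    intSeries_tendsto_value_of_tendsto_zero hT0 hv'
  have haw_lim : Tendsto (fun k ↦ a k ^ 2 * w k) atTop (𝓝 c') :=
    intSeries_tendsto_value_of_tendsto_zero hT'0 hw'
  have hvne : ∀ᶠ k in atTop, v k ≠ 0 := by
    filter_upwards [eventually_norm_eq_of_tendsto hc0 hv_lim] with k hk
    rw [← norm_ne_zero_iff, hk, norm_ne_zero_iff]
    exact hc0
  have hwne : ∀ᶠ k in atTop, w k ≠ 0 := by
    filter_upwards [eventually_norm_eq_of_tendsto hc0 hw_lim] with k hk
    rw [← norm_ne_zero_iff, hk, norm_ne_zero_iff]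
    exact hc0
  -- (ii) `a_k → ρ` and `a_k² → ρ`
  set ρ : ℂ_[p] := c' / c with hρdef
  have ha_lim : Tendsto a atTop (𝓝 ρ) := by
    refine (hav_lim.div hv_lim hc0).congr' ?_
    filter_upwards [hvne] with k hk
    simp only [Pi.div_apply]
    exact mul_div_cancel_right₀ (a k) hk
  have ha2_lim : Tendsto (fun k ↦ a k ^ 2) atTop (𝓝 ρ) := by
    refine (haw_lim.div hw_lim hc0).congr' ?_
    filter_upwards [hwne] with k hk
    simp only [Pi.div_apply]
    exact mul_div_cancel_right₀ (a k ^ 2) hk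
  have hρsq : ρ ^ 2 = ρ := tendsto_nhds_unique (ha_lim.pow 2) ha2_lim
  have hc'ρ : c' = ρ * c := by rw [hρdef, div_mul_cancel₀ _ hc0]
  have hρ01 : ρ = 0 ∨ ρ = 1 := by
    have h : ρ * (ρ - 1) = 0 := by rw [mul_sub, mul_one, ← sq, hρsq, sub_self]
    rcases mul_eq_zero.mp h with h | h
    · exact Or.inl h
    · exact Or.inr (sub_eq_zero.mp h)
  rcases hρ01 with hρ0 | hρ1
  · -- (ii') `ρ = 0` is impossible
    exfalso
    have ha0 : Tendsto a atTop (𝓝 0) := hρ0 ▸ ha_lim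
    obtain ⟨K, hK⟩ := hvne.exists
    have hQ'ne : Q' ≠ 0 := by
      intro h0
      have h00 := intSeries_hasValueAt_zero_series (p := p) (T K)
      rw [← h0] at h00
      exact mul_ne_zero (ha K) hK ((hv' K).unique h00)
    set d : ℕ := Q'.order.toNat with hddef
    set g₀ : ℂ_[p] := ((coeff d Q' : 𝓞_ℂ_[p]) : ℂ_[p]) with hg₀def
    have hg₀ : g₀ ≠ 0 := by
      rw [hg₀def, Ne, ZeroMemClass.coe_eq_zero, hddef]
      exact coeff_order hQ'ne
    have hg₀pos : 0 < ‖g₀‖ := norm_pos_iff.mpr hg₀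
    have h2pos : 0 < ‖(2 : ℂ_[p])‖ := norm_pos_iff.mpr two_ne_zero
    have h2d : 0 < ‖(2 : ℂ_[p])‖ ^ d := pow_pos h2pos d
    have hTn : Tendsto (fun k ↦ ‖T k‖) atTop (𝓝 0) := tendsto_zero_iff_norm_tendsto_zero.mp hT0
    have hT'n : Tendsto (fun k ↦ ‖T k * (T k + 2)‖) atTop (𝓝 0) :=
      tendsto_zero_iff_norm_tendsto_zero.mp hT'0
    have han : Tendsto (fun k ↦ ‖a k‖) atTop (𝓝 0) := tendsto_zero_iff_norm_tendsto_zero.mp ha0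
    have E1 : ∀ᶠ k in atTop, ‖T k‖ < 1 := hTn.eventually_lt_const zero_lt_one
    have E2 : ∀ᶠ k in atTop, ‖T k‖ < ‖g₀‖ := hTn.eventually_lt_const hg₀pos
    have E3 : ∀ᶠ k in atTop, ‖T k * (T k + 2)‖ < 1 := hT'n.eventually_lt_const zero_lt_one
    have E4 : ∀ᶠ k in atTop, ‖T k * (T k + 2)‖ < ‖g₀‖ := hT'n.eventually_lt_const hg₀pos
    have E5 : ∀ᶠ k in atTop, ‖v k‖ = ‖c‖ := eventually_norm_eq_of_tendsto hc0 hv_lim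
    have E6 : ∀ᶠ k in atTop, ‖w k‖ = ‖c‖ := eventually_norm_eq_of_tendsto hc0 hw_lim
    have E7 : ∀ᶠ k in atTop, ‖T k + 2‖ = ‖(2 : ℂ_[p])‖ :=
      eventually_norm_eq_of_tendsto two_ne_zero hT2
    have E8 : ∀ᶠ k in atTop, ‖a k‖ < ‖(2 : ℂ_[p])‖ ^ d := han.eventually_lt_const h2d
    obtain ⟨k, h1, h2, h3, h4, h5, h6, h7, h8⟩ :=
      (E1.and (E2.and (E3.and (E4.and (E5.and (E6.and (E7.and E8))))))).exists
    have hA : ‖a k‖ * ‖c‖ = ‖T k‖ ^ d * ‖g₀‖ := by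
      rw [← h5, ← norm_mul (a k) (v k)]
      exact intSeries_norm_value_eq_of_order h1 h2 (hv' k)
    have hB : ‖a k‖ ^ 2 * ‖c‖ = ‖T k‖ ^ d * ‖(2 : ℂ_[p])‖ ^ d * ‖g₀‖ := by
      rw [← h7, ← mul_pow, ← norm_mul (T k) (T k + 2), ← h6, ← norm_pow (a k) 2,
        ← norm_mul (a k ^ 2) (w k)]
      exact intSeries_norm_value_eq_of_order h3 h4 (hw' k)
    have hB' : ‖a k‖ ^ 2 * ‖c‖ = ‖(2 : ℂ_[p])‖ ^ d * (‖a k‖ * ‖c‖) := by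
      rw [hB, hA]; ring
    have hcpos : 0 < ‖c‖ := norm_pos_iff.mpr hc0
    have hak : ‖a k‖ = ‖(2 : ℂ_[p])‖ ^ d := by
      have hne : ‖a k‖ * ‖c‖ ≠ 0 := mul_ne_zero (norm_ne_zero_iff.mpr (ha k)) hcpos.ne'
      have : ‖a k‖ * (‖a k‖ * ‖c‖) = ‖(2 : ℂ_[p])‖ ^ d * (‖a k‖ * ‖c‖) := by rw [← hB']; ring
      exact mul_right_cancel₀ hne this
    exact (lt_irrefl _) (hak ▸ h8)
  · -- (iii) `ρ = 1`: `c' = c`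
    have hcc : c' = c := by rw [hc'ρ, hρ1, one_mul]
    exact Subtype.ext hcc

/-- **Abstract core (symmetric form)** over `𝓞_{ℂ_p}⟦T⟧` (x11b3-p3's `Halves.constantCoeff_eq_of_values_mul_sq`
verbatim): WITHOUT `[T⁰]Q ≠ 0`. [folklore] -/
theorem intSeries_constantCoeff_eq_of_values_mul_sq {Q Q' : PowerSeries 𝓞_ℂ_[p]}
    {T v w a : ℕ → ℂ_[p]} (hT0 : Tendsto T atTop (𝓝 0)) (ha : ∀ k, a k ≠ 0)
    (hv : ∀ k, IntSeries.HasValueAt Q (T k) (v k))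
    (hv' : ∀ k, IntSeries.HasValueAt Q' (T k) (a k * v k))
    (hw : ∀ k, IntSeries.HasValueAt Q (T k * (T k + 2)) (w k))
    (hw' : ∀ k, IntSeries.HasValueAt Q' (T k * (T k + 2)) (a k ^ 2 * w k)) :
    constantCoeff Q' = constantCoeff Q := by
  by_cases hc : constantCoeff Q = 0
  · by_cases hc' : constantCoeff Q' = 0
    · rw [hc, hc']
    · refine (intSeries_constantCoeff_eq_of_values_mul_sq_of_ne_zero (Q := Q') (Q' := Q)
        (a := fun k ↦ (a k)⁻¹) (v := fun k ↦ a k * v k) (w := fun k ↦ a k ^ 2 * w k)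
        hT0 (fun k ↦ inv_ne_zero (ha k)) hv' (fun k ↦ ?_) hw' (fun k ↦ ?_) hc').symm
      · simpa only [inv_mul_cancel_left₀ (ha k)] using hv k
      · have h : (a k)⁻¹ ^ 2 * (a k ^ 2 * w k) = w k := by
          rw [← mul_assoc, ← mul_pow, inv_mul_cancel₀ (ha k), one_pow, one_mul]
        simpa only [h] using hw k
  · exact intSeries_constantCoeff_eq_of_values_mul_sq_of_ne_zero hT0 ha hv hv' hw hw' hc

end Core

end Summit.BirchSwinnertonDyer.Rank1Residual.X11b

end
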